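/-
Copyright (c) 2026 the pub-hodgecm-mathlib formalisation cell (harness21).  Prover seat hodgecm-mathlib-LH4-p11 (g5), req620 Track A «(D-RAM) FOUR-FRAME» squad
(unit U2H_HSide, the (ρ2b′-X) road :418; bottom socket (A), recipe item 12 «the V-choice», part 2: the depth `c := ϖ^N`).
-/
import Literature.NumberTheory.Automorphic.UnitaryThreeFourFrameDefs   -- ★ (valued-field letters)
import HarnessLib

/-!
# Crux `H413`, line LH4 «(D-RAM) FOUR-FRAME» — the (ρ2b′-X) road, bottom sockets: THE LETTERS OF THE DEPTH `c := ϖ^N`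

Cell `hodgecm-mathlib` (D-0151), FLOOR 0, crux item H413 = `stmt-HodgeConjecture-24833`; squad F0∕P3c∕LH4; bottom sockets (A)∕(B)∕(C).  The bottom prover chooses
`V ∈ 𝓝 1` by ★ `exists_nhds_one_congrOne_endoEmbLocal (c := ϖ^N)`; the ★ organs then want numeric side conditions on `c` — `c ≠ 0`, `|c| ≤ 1`, `|c| < |2|` (★ TubeLetters'
`v_trace_eq_v_two`), `|c|² < |4|·|ϖ|²·|2|²` (the (C2) tube ★ `v_disc_lt_tube`), `|c| < |4|` (★ `exists_normOne_sqrt`), `|c| ≤ exp(−N)` (★ `le_two_mul_depth_of_congr`) — and the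
square-root letters of ★ O-Sign (`hdeep : |u∕δ − 1| ≤ |ϖ|^n` from `δ² = det`, `|δ − 1| < |2|`).  All of it is valuation arithmetic over a valued field `K` with `|ϖ| = exp(−1)` and
`|2| = |ϖ|^t` (the letters of ★ `IsRamifiedQuadraticDatum`), each lemma carrying its own minimal hypothesis on `N`.
THEOREMS ONLY (no `def`, no instance, no notation, no `sorry`, default heartbeats); lane `--supports stmt-HodgeConjecture-24833 --as helper` (count-neutral).
HONEST LABEL.  Count-neutral; nothing printed is asserted; (ρ2b′-X) stays OPEN; `HC_CM` is proved only modulo the 7 printed citations (2 remaining named inputs: hLiu418 =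
`stmt-HodgeConjecture-24832`, h413 = `stmt-HodgeConjecture-24833`) until rung 0 closes.

## References
* [Serre1979] J.-P. Serre, *Local Fields*, GTM 67 (1979), Ch. II §1 (discrete valuations), Ch. XIV §4 (units near `1`, square roots).
* [BernsteinZelevinsky1976] I. N. Bernstein, A. V. Zelevinsky, *Representations of GL(n, F)*, Russian Math. Surveys 31 (1976), §1.1 (congruence neighbourhoods).
-/

set_option autoImplicit false

noncomputable section

open scoped Valued WithZero
open WithZero

namespace Summit.HodgeConjecture.HodgeConjecture.Cruxes.H413.F0P3cDyRamUniformizerPowerTube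

variable {K : Type*} [Field K] [Valued K ℤᵐ⁰]

/-! ## §1 `|ϖ^N|` -/

/-- `|ϖ^N| = exp(−N)`. [cite: Serre1979, Ch. II §1] -/
theorem v_pow_eq_exp_neg {ϖ : K} (hϖ : Valued.v ϖ = exp (-1 : ℤ)) (N : ℕ) : Valued.v (ϖ ^ N) = exp (-(N : ℤ)) := by
  rw [map_pow, hϖ, ← exp_nsmul]; congr 1; simp

/-- `ϖ^N ≠ 0`. [cite: Serre1979, Ch. II §1] -/
theorem pow_ne_zero_of_v {ϖ : K} (hϖ : Valued.v ϖ = exp (-1 : ℤ)) (N : ℕ) : ϖ ^ N ≠ 0 := by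
  intro h
  have := v_pow_eq_exp_neg hϖ N
  rw [h, map_zero] at this
  exact WithZero.zero_ne_coe this

/-- `|ϖ^N| ≤ 1`. [cite: Serre1979, Ch. II §1] -/
theorem v_pow_le_one {ϖ : K} (hϖ : Valued.v ϖ = exp (-1 : ℤ)) (N : ℕ) : Valued.v (ϖ ^ N) ≤ 1 := by
  rw [v_pow_eq_exp_neg hϖ, ← exp_zero, exp_le_exp]; omega

/-- `|ϖ|^b ≤ |ϖ|^a` for `a ≤ b`. [cite: Serre1979, Ch. II §1] -/
theorem v_pow_le_v_pow {ϖ : K} (hϖ : Valued.v ϖ = exp (-1 : ℤ)) {a b : ℕ} (h : a ≤ b) : Valued.v ϖ ^ b ≤ Valued.v ϖ ^ a := by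
  rw [← map_pow, ← map_pow, v_pow_eq_exp_neg hϖ, v_pow_eq_exp_neg hϖ, exp_le_exp]; omega

/-- `|ϖ|^b < |ϖ|^a` for `a < b`. [cite: Serre1979, Ch. II §1] -/
theorem v_pow_lt_v_pow {ϖ : K} (hϖ : Valued.v ϖ = exp (-1 : ℤ)) {a b : ℕ} (h : a < b) : Valued.v ϖ ^ b < Valued.v ϖ ^ a := by
  rw [← map_pow, ← map_pow, v_pow_eq_exp_neg hϖ, v_pow_eq_exp_neg hϖ, exp_lt_exp]; omega

/-- `|ϖ^N| ≤ exp(−N)` (the shape ★ `le_two_mul_depth_of_congr` wants). [cite: Serre1979, Ch. II §1] -/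
theorem v_pow_le_exp_neg {ϖ : K} (hϖ : Valued.v ϖ = exp (-1 : ℤ)) (N : ℕ) : Valued.v (ϖ ^ N) ≤ exp (-(N : ℤ)) :=
  (v_pow_eq_exp_neg hϖ N).le

/-! ## §2 Against `|2| = |ϖ|^t` -/

/-- `|ϖ^N| < |2|` once `t < N`. [cite: Serre1979, Ch. XIV §4] -/
theorem v_pow_lt_v_two {ϖ : K} (hϖ : Valued.v ϖ = exp (-1 : ℤ)) {t : ℕ} (h2 : Valued.v (2 : K) = Valued.v ϖ ^ t) {N : ℕ} (hN : t < N) :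
    Valued.v (ϖ ^ N) < Valued.v (2 : K) := by
  rw [h2, map_pow]; exact v_pow_lt_v_pow hϖ hN

/-- `|ϖ^N| < |4|` once `2t < N`. [cite: Serre1979, Ch. XIV §4] -/
theorem v_pow_lt_v_four {ϖ : K} (hϖ : Valued.v ϖ = exp (-1 : ℤ)) {t : ℕ} (h2 : Valued.v (2 : K) = Valued.v ϖ ^ t) {N : ℕ} (hN : 2 * t < N) :
    Valued.v (ϖ ^ N) < Valued.v (4 : K) := by
  rw [show (4 : K) = 2 * 2 by norm_num, map_mul, h2, ← pow_add, map_pow]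
  exact v_pow_lt_v_pow hϖ (by omega)

/-- THE (C2) TUBE: `|ϖ^N|² < |4|·|ϖ|²·|2|²` once `2t + 2 ≤ N`. [cite: Serre1979, Ch. XIV §4] -/
theorem v_pow_sq_lt_tube {ϖ : K} (hϖ : Valued.v ϖ = exp (-1 : ℤ)) {t : ℕ} (h2 : Valued.v (2 : K) = Valued.v ϖ ^ t) {N : ℕ} (hN : 2 * t + 2 ≤ N) :
    Valued.v (ϖ ^ N) ^ 2 < Valued.v (4 : K) * Valued.v ϖ ^ 2 * Valued.v (2 : K) ^ 2 := by
  rw [show (4 : K) = 2 * 2 by norm_num, map_mul, h2, map_pow, ← pow_mul, ← pow_add, ← pow_mul, ← pow_add, ← pow_add]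
  exact v_pow_lt_v_pow hϖ (by omega)

/-- `1 ≤ t` when `|2| < 1`. [cite: Serre1979, Ch. XIV §4] -/
theorem one_le_of_v_two_lt_one {ϖ : K} {t : ℕ} (h2 : Valued.v (2 : K) = Valued.v ϖ ^ t)
    (h2v : Valued.v (2 : K) < 1) : 1 ≤ t := by
  by_contra h
  have ht : t = 0 := by omega
  rw [h2, ht, pow_zero] at h2v
  exact lt_irrefl _ h2v

/-! ## §3 The square-root letters (★ O-Sign's `δ`, `hdeep`) -/

/-- If `r² = D` and `|r − 1| < |2|` then `|r − 1|·|2| = |D − 1|` (`D − 1 = (r − 1)(r + 1)`, `|r + 1| = |(r − 1) + 2| = |2|`). [cite: Serre1979, Ch. XIV §4] -/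
theorem v_sub_one_mul_v_two_eq {r D : K} (hrr : r * r = D) (hr1 : Valued.v (r - 1) < Valued.v (2 : K)) :
    Valued.v (r - 1) * Valued.v (2 : K) = Valued.v (D - 1) := by
  have hr2 : Valued.v (r + 1) = Valued.v (2 : K) := by
    rw [show r + 1 = 2 + (r - 1) by ring]; exact Valuation.map_add_eq_of_lt_left _ hr1
  rw [← hr2, ← map_mul, show (r - 1) * (r + 1) = D - 1 by rw [← hrr]; ring]

/-- If `r² = D`, `|r − 1| < |2| = |ϖ|^t` and `|D − 1| ≤ |ϖ^N|` with `t ≤ N`, then `|r − 1| ≤ |ϖ|^(N − t)`. [cite: Serre1979, Ch. XIV §4] -/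
theorem v_sqrt_sub_one_le {ϖ : K} (hϖ : Valued.v ϖ = exp (-1 : ℤ)) {t : ℕ} (h2 : Valued.v (2 : K) = Valued.v ϖ ^ t)
    {r D : K} (hrr : r * r = D) (hr1 : Valued.v (r - 1) < Valued.v (2 : K)) {N : ℕ} (hD1 : Valued.v (D - 1) ≤ Valued.v (ϖ ^ N)) (htN : t ≤ N) :
    Valued.v (r - 1) ≤ Valued.v ϖ ^ (N - t) := by
  have h := v_sub_one_mul_v_two_eq hrr hr1
  have h2ne : Valued.v (2 : K) ≠ 0 := by rw [h2, ← map_pow]; exact fun h0 => pow_ne_zero_of_v hϖ t ((map_eq_zero _).1 h0)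
  have hle : Valued.v (r - 1) * Valued.v (2 : K) ≤ Valued.v ϖ ^ (N - t) * Valued.v (2 : K) := by
    rw [h, h2, ← pow_add, Nat.sub_add_cancel htN, ← map_pow]; exact hD1
  exact le_of_mul_le_mul_right hle (zero_lt_iff.2 h2ne)

/-- `|u∕δ − 1| ≤ x` when `|u − 1| ≤ x`, `|δ − 1| ≤ x` and `|δ − 1| < 1` (so `|δ| = 1` and `u∕δ − 1 = ((u − 1) − (δ − 1))∕δ`). [cite: Serre1979, Ch. XIV §4] -/
theorem v_div_sub_one_le {u δ : K} {x : ℤᵐ⁰} (hδ1 : Valued.v (δ - 1) < 1) (hu : Valued.v (u - 1) ≤ x) (hδ : Valued.v (δ - 1) ≤ x) :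
    Valued.v (u / δ - 1) ≤ x := by
  have hδv : Valued.v δ = 1 := by
    have h := Valuation.map_add_eq_of_lt_left Valued.v (show Valued.v (δ - 1) < Valued.v (1 : K) by rwa [map_one])
    rw [map_one, show (1 : K) + (δ - 1) = δ by ring] at h
    exact h
  have hδ0 : δ ≠ 0 := fun h => by rw [h, map_zero] at hδv; exact zero_ne_one hδv
  rw [show u / δ - 1 = ((u - 1) - (δ - 1)) / δ by field_simp; ring, map_div₀, hδv, div_one]
  exact (Valuation.map_sub _ _ _).trans (max_le hu hδ)

/-! ## §4 One depth that satisfies every organ -/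

/-- THE RECORD DEPTH.  With `n := 2d + 2t + 2` and `N := n + t` all side conditions hold at once: `2d + t ≤ 2n + 1`, `2t < n` (★ O-Sign), `t < N`, `2t < N`,
`2t + 2 ≤ N`, `t ≤ N`, `N − t = n`, and `2d ≤ N` (so ★ `le_two_mul_depth_of_congr` gives `d ≤ m`, whence the weld's `d − d % 2 ≤ m + 1`). [cite: BernsteinZelevinsky1976, §1.1] -/
theorem recordDepth_spec (d t : ℕ) :
    2 * d + t ≤ 2 * (2 * d + 2 * t + 2) + 1 ∧ 2 * t < 2 * d + 2 * t + 2 ∧ t < 2 * d + 2 * t + 2 + t ∧ 2 * t < 2 * d + 2 * t + 2 + t ∧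
      2 * t + 2 ≤ 2 * d + 2 * t + 2 + t ∧ t ≤ 2 * d + 2 * t + 2 + t ∧ 2 * d + 2 * t + 2 + t - t = 2 * d + 2 * t + 2 ∧ 2 * d ≤ 2 * d + 2 * t + 2 + t := by
  omega

/-- From `N ≤ 2m` and `2d ≤ N`: the weld's `d − d % 2 ≤ m + 1`. [cite: BernsteinZelevinsky1976, §1.1] -/
theorem sub_mod_two_le_of_le_two_mul {d N m : ℕ} (hN : N ≤ 2 * m) (hd : 2 * d ≤ N) : d - d % 2 ≤ m + 1 := by
  omega

end Summit.HodgeConjecture.HodgeConjecture.Cruxes.H413.F0P3cDyRamUniformizerPowerTube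

end
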